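import Summits.BirchSwinnertonDyer.BirchSwinnertonDyer.Theorems.EdixhovenFibreFiveSevenReceptacleAdditiveElevenLe
import Summits.BirchSwinnertonDyer.BirchSwinnertonDyer.Theorems.EdixhovenFibreFiveSevenReceptacleTorsionDescent
import Literature.NumberTheory.EllipticCurves.VariableChangePointsMap
import HarnessLib

/-!
# The receptacle `log_ω(E₀(K_v)) = 𝒪_{K_v}` under EXACTLY the side clause of F″ —
# `7 < p ∨ (gcd([K_v : ℚ_p], p − 1) = 1 ∧ E(ℚ_p)[p] = 0)` — at every additive `p ≥ 5`, `K_v/ℚ_p` Galois unramified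

Route `EdixhovenFibreFiveSeven`, crux K★ `StarredOptimalManinUnitFiveSeven` (stmt-BirchSwinnertonDyer-22226),
line `kato-lever`, seat `bsd-line-edix-p2` g4; `--supports` 22226 (helper toward the ONE open stub F″ =
`Literature.NumberTheory.EllipticCurves.kato_neron_isIntegral_twistedSymbolSum_of_additive_five_le`, programme piece
P2 of `Cruxes/StarredOptimalManinUnitFiveSeven/Lines/kato-lever-F2-programme.md`). TOOL theorems only (no definition,
no named fact, no `sorry`); nothing is closed or booked; BSD is not proved by any of this.

WHY. Item 2 (RECEPTACLE) of F″'s derivation is Kim–Nakamura Cor. 2.4 over the completions `K_v = ℚ(ζ_m)_v`, `v ∣ p`,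
unramified of degree `ord_m p`, under F″'s side clause `7 < p ∨ (gcd(ord_m p, p − 1) = 1 ∧ V(ℚ_p)[p] = 0)`. Its
log side `Λ̃ : E₀(K_v) ↠ 𝒪_{K_v}` is seat edix-p1 g5's p596837 modulo `E₀(K_v)[p] = 0`; that hypothesis is this
seat's p598307 (`7 < p`: any additive model, no exception) and p598079 (`gcd ∧ E(ℚ_p)[p] = 0`: Galois descent, any
reduction type). THIS file assembles the two branches into the receptacle under F″'s clause VERBATIM — the disjunction
`7 < p ∨ (Nat.Coprime (Module.finrank ℚ_[p] K) (p − 1) ∧ ∀ P : (V ⊗ ℚ_p)(ℚ_p), p • P = 0 → P = 0)` — for any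
additive `M/ℤ_p` (`§1`) and for the minimal model `W_ℤ ⊗ ℤ_p` of a globally minimal `W/ℚ` with `Addv W p`, where the
`ℚ_p`-torsion clause is read on `W.baseChange ℚ_[p]` exactly as F″ types it (`§2`, bridge `map_coe_integralModelInt`).
What then remains of «F″ ⟸ P1» at the receptacle is only (S5b) (`PAdicHodge.exists_smul_range_expStarCoord_iff_trace_log`,
cite-only) and the identification `[K_v : ℚ_p] = ord_m p` for `K_v = ℚ(ζ_m)_v` (P4, seat manin-p1 g8).

* §1 `noPTorsion_of_katoClause` (any additive `M/ℤ_p`, `5 ≤ p`, `K/ℚ_p` finite Galois unramified, F″'s clause on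
  `M ⊗ ℚ_p` ⟹ `E₀(K)[p] = 0`), ★ `exists_mem_nonsingularReductionSubgroup_satLog_eq_of_katoClause` (`Λ̃ : E₀(K) ↠ 𝒪_K`),
  `satLog_eq_zero_iff_of_katoClause`, `exists_mem_nonsingularReductionSubgroup_padicLogPointFiniteExt_eq_of_katoClause`,
  ★ `norm_trace_mul_le_one_of_forall_point_of_katoClause` ((S5b) currency: `exp*_ω(H¹(K,T)) ⊆ 𝒪_K^∨`).
* §2 the same for `W_ℤ ⊗ K`, `Addv W p`, clause on `W.baseChange ℚ_[p]` (`…_of_addv_of_katoClause`).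

References: [KimNakamura2020] C.-H. Kim, K. Nakamura, J. Number Theory 210 (2020), Thm. 2.1, Cor. 2.3, Cor. 2.4,
Remark 1.8 (1); [KostersPannekoek2017] M. Kosters, R. Pannekoek, arXiv:1703.07888, Thm. 1, Cor. 2; [Kato2004Asterisque]
K. Kato, Astérisque 295 (2004), (8.1.3), Thm. 9.7 (the consumer F″); [SilvermanAEC2009] J. H. Silverman, *AEC* 2nd ed.,
VII.2, IV.6.4, III.8.1.1.
-/

set_option autoImplicit false
-- the Theorems namespace of a single-conjunct summit repeats the summit name by design (D-0017)
set_option linter.dupNamespace false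

noncomputable section

open scoped Classical NNReal
open WeierstrassCurve Literature.NumberTheory.EllipticCurves Literature.NumberTheory.EllipticCurves.FormalGroupChart
open Summit.BirchSwinnertonDyer.Rank1Residual.Additive
open Summit.BirchSwinnertonDyer.Rank1Residual.Additive.BallEval
open Summit.BirchSwinnertonDyer.BirchSwinnertonDyer.Theorems.KPort
open Summit.BirchSwinnertonDyer.BirchSwinnertonDyer.Theorems.StarredOptimalManinUnitFiveSevenReceptacle
open Literature.NumberTheory.GaloisRepresentations.LubinTate (unitBall mem_unitBall_iff)

namespace Summit.BirchSwinnertonDyer.BirchSwinnertonDyer.Theorems.ReceptacleTorsion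

variable {p : ℕ} [hp : Fact p.Prime] {K : Type*} [NontriviallyNormedField K] [NormedAlgebra ℚ_[p] K]
  [IsUltrametricDist K] [FiniteDimensional ℚ_[p] K] [IsGalois ℚ_[p] K]

/-! ## §1 Any additive `M/ℤ_p`, `p ≥ 5`, under F″'s clause -/

section Model

variable {M : WeierstrassCurve ℤ_[p]} [hE : (M.map PadicInt.Coe.ringHom).IsElliptic]

/-- **`E₀(K)[p] = 0` under F″'s side clause**: `M/ℤ_p` with `‖Δ‖, ‖c₄‖ < 1` (additive), `5 ≤ p`, `K/ℚ_p` finite Galois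
UNRAMIFIED, and `7 < p ∨ (gcd([K : ℚ_p], p − 1) = 1 ∧ (M ⊗ ℚ_p)(ℚ_p)[p] = 0)`: by p598307 (`7 < p`, so `11 ≤ p`) or
p598079 (descent). [cite: KostersPannekoek2017, Thm. 1 and Cor. 2] [cite: KimNakamura2020, Thm. 2.1, Remark 1.8 (1)] -/
theorem noPTorsion_of_katoClause (hp5 : 5 ≤ p) (hK : ∀ z : K, ‖z‖ < 1 → ‖z‖ ≤ ‖(p : K)‖)
    (hΔ : ‖M.Δ‖ < 1) (hc₄ : ‖M.c₄‖ < 1)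
    (hcl : 7 < p ∨ (Nat.Coprime (Module.finrank ℚ_[p] K) (p - 1) ∧
      ∀ P₀ : (M.map PadicInt.Coe.ringHom).toAffine.Point, p • P₀ = 0 → P₀ = 0))
    {P : (curveK p K M).toAffine.Point}
    (hP : P ∈ (M.map (coeffHom p K)).nonsingularReductionSubgroup
      (Valuation.integer.integers (NormedField.valuation (K := K))))
    (hpP : p • P = 0) : P = 0 := by
  rcases hcl with h7 | ⟨hcop, h0⟩
  · have h11 : 11 ≤ p := by
      rcases CuspTorsion.eq_five_or_eq_seven_or_eleven_le (p := p) hp5 with h | h | h <;> omega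
    exact noPTorsion_of_additive_eleven_le h11 hK hΔ hc₄ hP hpP
  · exact eq_zero_of_prime_nsmul_eq_zero_of_unramified_of_coprime (by omega) hK hcop h0 hpP

variable [CompleteSpace K] [hint : (curveK p K M).IsIntegral (NormedField.valuation (K := K)).integer]

/-- ★ **THE RECEPTACLE UNDER F″'s CLAUSE.** `M/ℤ_p` with `‖Δ‖, ‖c₄‖ < 1`, `5 ≤ p`, `K/ℚ_p` finite Galois UNRAMIFIED,
`7 < p ∨ (gcd([K : ℚ_p], p − 1) = 1 ∧ (M ⊗ ℚ_p)(ℚ_p)[p] = 0)`: `Λ̃ : E₀(K) ↠ 𝒪_K` — Kim–Nakamura Thm. 2.1 / Cor. 2.3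
over `K`. [cite: KimNakamura2020, Thm. 2.1, Cor. 2.3] [cite: KostersPannekoek2017, Thm. 1] -/
theorem exists_mem_nonsingularReductionSubgroup_satLog_eq_of_katoClause (hp5 : 5 ≤ p)
    (hK : ∀ z : K, ‖z‖ < 1 → ‖z‖ ≤ ‖(p : K)‖) (hΔ : ‖M.Δ‖ < 1) (hc₄ : ‖M.c₄‖ < 1)
    (hcl : 7 < p ∨ (Nat.Coprime (Module.finrank ℚ_[p] K) (p - 1) ∧
      ∀ P₀ : (M.map PadicInt.Coe.ringHom).toAffine.Point, p • P₀ = 0 → P₀ = 0))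
    {y : K} (hy : ‖y‖ ≤ 1) :
    ∃ P ∈ (M.map (coeffHom p K)).nonsingularReductionSubgroup
        (Valuation.integer.integers (NormedField.valuation (K := K))), satLog p K M P = y :=
  exists_mem_nonsingularReductionSubgroup_satLog_eq (by omega) hK hΔ hc₄
    (fun _ hP hpP => noPTorsion_of_katoClause hp5 hK hΔ hc₄ hcl hP hpP) hy

/-- `Λ̃ P = 0 ↔ P = O` on `E₀(K)` (same hypotheses): `Λ̃ : E₀(K) ⥲ 𝒪_K`. [cite: KostersPannekoek2017, Thm. 1]
[cite: SilvermanAEC2009, VII.2 Prop. 2.1 and Thm. IV.6.4] -/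
theorem satLog_eq_zero_iff_of_katoClause (hp5 : 5 ≤ p) (hK : ∀ z : K, ‖z‖ < 1 → ‖z‖ ≤ ‖(p : K)‖)
    (hΔ : ‖M.Δ‖ < 1) (hc₄ : ‖M.c₄‖ < 1)
    (hcl : 7 < p ∨ (Nat.Coprime (Module.finrank ℚ_[p] K) (p - 1) ∧
      ∀ P₀ : (M.map PadicInt.Coe.ringHom).toAffine.Point, p • P₀ = 0 → P₀ = 0))
    {P : (curveK p K M).toAffine.Point}
    (hP : P ∈ (M.map (coeffHom p K)).nonsingularReductionSubgroup
      (Valuation.integer.integers (NormedField.valuation (K := K)))) :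
    satLog p K M P = 0 ↔ P = 0 :=
  satLog_eq_zero_iff_of_mem_nonsingularReductionSubgroup (by omega) hK hΔ hc₄
    (fun _ hP hpP => noPTorsion_of_katoClause hp5 hK hΔ hc₄ hcl hP hpP) hP

/-- (S5b) currency: every `y ∈ 𝒪_K` is `log_ω(P) = padicLogPointFiniteExt ‖·‖ E p P` for some `P ∈ E₀(K)` (same
hypotheses). [cite: KimNakamura2020, Cor. 2.4] -/
theorem exists_mem_nonsingularReductionSubgroup_padicLogPointFiniteExt_eq_of_katoClause (hp5 : 5 ≤ p)
    (hK : ∀ z : K, ‖z‖ < 1 → ‖z‖ ≤ ‖(p : K)‖) (hΔ : ‖M.Δ‖ < 1) (hc₄ : ‖M.c₄‖ < 1)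
    (hcl : 7 < p ∨ (Nat.Coprime (Module.finrank ℚ_[p] K) (p - 1) ∧
      ∀ P₀ : (M.map PadicInt.Coe.ringHom).toAffine.Point, p • P₀ = 0 → P₀ = 0))
    {y : K} (hy : ‖y‖ ≤ 1) :
    ∃ P ∈ (M.map (coeffHom p K)).nonsingularReductionSubgroup
        (Valuation.integer.integers (NormedField.valuation (K := K))),
      padicLogPointFiniteExt (NormedField.valuation (K := K)) (curveK p K M) p P = y :=
  exists_mem_nonsingularReductionSubgroup_padicLogPointFiniteExt_eq (by omega) hK hΔ hc₄
    (fun _ hP hpP => noPTorsion_of_katoClause hp5 hK hΔ hc₄ hcl hP hpP) hy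

/-- ★ **The trace form consumed with (S5b), under F″'s clause**: if `‖Tr_{K/ℚ_p}(a · log_ω P)‖ ≤ 1` for every
`P ∈ E(K)` (`a ∈ exp*_ω(H¹(K, T_pE))` by `PAdicHodge.exists_smul_range_expStarCoord_iff_trace_log`), then
`‖Tr_{K/ℚ_p}(a · o)‖ ≤ 1` for every `o ∈ 𝒪_K`: `exp*_ω(H¹(K_v, T_pE)) ⊆ 𝒪_v^∨ = 𝒪_v` — Kim–Nakamura Cor. 2.4 over the
unramified completions, i.e. item 2 of F″'s derivation as a theorem modulo (S5b).
[cite: KimNakamura2020, Cor. 2.4] [cite: KostersPannekoek2017, Thm. 1 and Cor. 2] -/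
theorem norm_trace_mul_le_one_of_forall_point_of_katoClause (hp5 : 5 ≤ p)
    (hK : ∀ z : K, ‖z‖ < 1 → ‖z‖ ≤ ‖(p : K)‖) (hΔ : ‖M.Δ‖ < 1) (hc₄ : ‖M.c₄‖ < 1)
    (hcl : 7 < p ∨ (Nat.Coprime (Module.finrank ℚ_[p] K) (p - 1) ∧
      ∀ P₀ : (M.map PadicInt.Coe.ringHom).toAffine.Point, p • P₀ = 0 → P₀ = 0))
    {a : K}
    (ha : ∀ P : (curveK p K M).toAffine.Point,
      ‖Algebra.trace ℚ_[p] K (a * padicLogPointFiniteExt (NormedField.valuation (K := K)) (curveK p K M) p P)‖ ≤ 1)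
    {o : K} (ho : ‖o‖ ≤ 1) : ‖Algebra.trace ℚ_[p] K (a * o)‖ ≤ 1 :=
  norm_trace_mul_le_one_of_forall_point (by omega) hK hΔ hc₄
    (fun _ hP hpP => noPTorsion_of_katoClause hp5 hK hΔ hc₄ hcl hP hpP) ha ho

end Model

/-! ## §2 The minimal model `W_ℤ ⊗ K` of `W/ℚ` at an additive `p ≥ 5`, clause read on `W.baseChange ℚ_[p]` as in F″ -/

section Rat

variable (W : WeierstrassCurve ℚ) [W.IsElliptic] [W.IsGloballyMinimal]

omit [IsUltrametricDist K] [FiniteDimensional ℚ_[p] K] [IsGalois ℚ_[p] K] [NontriviallyNormedField K]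
  [NormedAlgebra ℚ_[p] K] [W.IsElliptic] in
/-- F″'s `ℚ_p`-torsion clause, typed on `W.baseChange ℚ_[p]`, moved to the generic fibre of the `ℤ_p`-model
`W_ℤ ⊗ ℤ_p` (bridge `map_coe_integralModelInt`, identity on coordinates). [folklore] -/
theorem noPTorsion_padic_of_baseChange
    (h0 : ∀ P : (W.baseChange ℚ_[p]).toAffine.Point, p • P = 0 → P = 0)
    (P₀ : (((integralModelInt W).map (Int.castRingHom ℤ_[p])).map PadicInt.Coe.ringHom).toAffine.Point)
    (hP₀ : p • P₀ = 0) : P₀ = 0 := by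
  have hM : ((integralModelInt W).map (Int.castRingHom ℤ_[p])).map PadicInt.Coe.ringHom = W.baseChange ℚ_[p] :=
    map_coe_integralModelInt W
  set e := Affine.Point.congrEquiv hM with he
  have h1 : p • e P₀ = 0 := by rw [← map_nsmul, hP₀, map_zero]
  exact e.injective ((h0 _ h1).trans (map_zero e).symm)

/-- **`E₀(K)[p] = 0` for `W_ℤ ⊗ K` under F″'s clause**: `W/ℚ` globally minimal, `Addv W p`, `5 ≤ p`, `K/ℚ_p` finite
Galois UNRAMIFIED, `7 < p ∨ (gcd([K : ℚ_p], p − 1) = 1 ∧ ∀ P : (W ⊗ ℚ_p)(ℚ_p), p • P = 0 → P = 0)`.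
[cite: KostersPannekoek2017, Thm. 1 and Cor. 2] [cite: KimNakamura2020, Thm. 2.1, Remark 1.8 (1)] -/
theorem noPTorsion_of_addv_of_katoClause (hp5 : 5 ≤ p) (hadd : Rank1Residual.Addv W p)
    (hK : ∀ z : K, ‖z‖ < 1 → ‖z‖ ≤ ‖(p : K)‖)
    (hcl : 7 < p ∨ (Nat.Coprime (Module.finrank ℚ_[p] K) (p - 1) ∧
      ∀ P : (W.baseChange ℚ_[p]).toAffine.Point, p • P = 0 → P = 0))
    {P : (curveK p K ((integralModelInt W).map (Int.castRingHom ℤ_[p]))).toAffine.Point}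
    (hP : P ∈ (((integralModelInt W).map (Int.castRingHom ℤ_[p])).map (coeffHom p K)).nonsingularReductionSubgroup
      (Valuation.integer.integers (NormedField.valuation (K := K))))
    (hpP : p • P = 0) : P = 0 := by
  haveI := isElliptic_map_integralModelInt_padic (p := p) W
  obtain ⟨hΔ, hc₄⟩ := norm_Δ_lt_one_of_addv (p := p) W hadd
  refine noPTorsion_of_katoClause hp5 hK hΔ hc₄ ?_ hP hpP
  rcases hcl with h7 | ⟨hcop, h0⟩
  · exact Or.inl h7
  · exact Or.inr ⟨hcop, noPTorsion_padic_of_baseChange (p := p) W h0⟩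

variable [CompleteSpace K]
  [(curveK p K ((integralModelInt W).map (Int.castRingHom ℤ_[p]))).IsIntegral (NormedField.valuation (K := K)).integer]

/-- ★ **THE RECEPTACLE OF F″ AS A THEOREM (log side).** `W/ℚ` globally minimal, `Addv W p`, `5 ≤ p`, `K/ℚ_p` finite
Galois UNRAMIFIED, and F″'s clause `7 < p ∨ (gcd([K : ℚ_p], p − 1) = 1 ∧ ∀ P : (W ⊗ ℚ_p)(ℚ_p), p • P = 0 → P = 0)`:
`Λ̃ : E₀(K) ↠ 𝒪_K` for the minimal model `W_ℤ ⊗ K`. [cite: KimNakamura2020, Thm. 2.1, Cor. 2.3]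
[cite: KostersPannekoek2017, Thm. 1 and Cor. 2] -/
theorem exists_mem_nonsingularReductionSubgroup_satLog_eq_of_addv_of_katoClause (hp5 : 5 ≤ p)
    (hadd : Rank1Residual.Addv W p) (hK : ∀ z : K, ‖z‖ < 1 → ‖z‖ ≤ ‖(p : K)‖)
    (hcl : 7 < p ∨ (Nat.Coprime (Module.finrank ℚ_[p] K) (p - 1) ∧
      ∀ P : (W.baseChange ℚ_[p]).toAffine.Point, p • P = 0 → P = 0))
    {y : K} (hy : ‖y‖ ≤ 1) :
    ∃ P ∈ (((integralModelInt W).map (Int.castRingHom ℤ_[p])).map (coeffHom p K)).nonsingularReductionSubgroup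
        (Valuation.integer.integers (NormedField.valuation (K := K))),
      satLog p K ((integralModelInt W).map (Int.castRingHom ℤ_[p])) P = y := by
  haveI := isElliptic_map_integralModelInt_padic (p := p) W
  obtain ⟨hΔ, hc₄⟩ := norm_Δ_lt_one_of_addv (p := p) W hadd
  exact exists_mem_nonsingularReductionSubgroup_satLog_eq (by omega) hK hΔ hc₄
    (fun _ hP hpP => noPTorsion_of_addv_of_katoClause W hp5 hadd hK hcl hP hpP) hy

/-- `Λ̃ P = 0 ↔ P = O` on `E₀(K)` of `W_ℤ ⊗ K` (same hypotheses). [cite: SilvermanAEC2009, VII.2 Prop. 2.1 and Thm. IV.6.4] -/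
theorem satLog_eq_zero_iff_of_addv_of_katoClause (hp5 : 5 ≤ p) (hadd : Rank1Residual.Addv W p)
    (hK : ∀ z : K, ‖z‖ < 1 → ‖z‖ ≤ ‖(p : K)‖)
    (hcl : 7 < p ∨ (Nat.Coprime (Module.finrank ℚ_[p] K) (p - 1) ∧
      ∀ P : (W.baseChange ℚ_[p]).toAffine.Point, p • P = 0 → P = 0))
    {P : (curveK p K ((integralModelInt W).map (Int.castRingHom ℤ_[p]))).toAffine.Point}
    (hP : P ∈ (((integralModelInt W).map (Int.castRingHom ℤ_[p])).map (coeffHom p K)).nonsingularReductionSubgroup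
      (Valuation.integer.integers (NormedField.valuation (K := K)))) :
    satLog p K ((integralModelInt W).map (Int.castRingHom ℤ_[p])) P = 0 ↔ P = 0 := by
  haveI := isElliptic_map_integralModelInt_padic (p := p) W
  obtain ⟨hΔ, hc₄⟩ := norm_Δ_lt_one_of_addv (p := p) W hadd
  exact satLog_eq_zero_iff_of_mem_nonsingularReductionSubgroup (by omega) hK hΔ hc₄
    (fun _ hP hpP => noPTorsion_of_addv_of_katoClause W hp5 hadd hK hcl hP hpP) hP

/-- (S5b) currency for `W_ℤ ⊗ K` under F″'s clause: every `y ∈ 𝒪_K` is `padicLogPointFiniteExt ‖·‖ E p P` for some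
`P ∈ E₀(K)`. [cite: KimNakamura2020, Cor. 2.4] -/
theorem exists_mem_nonsingularReductionSubgroup_padicLogPointFiniteExt_eq_of_addv_of_katoClause (hp5 : 5 ≤ p)
    (hadd : Rank1Residual.Addv W p) (hK : ∀ z : K, ‖z‖ < 1 → ‖z‖ ≤ ‖(p : K)‖)
    (hcl : 7 < p ∨ (Nat.Coprime (Module.finrank ℚ_[p] K) (p - 1) ∧
      ∀ P : (W.baseChange ℚ_[p]).toAffine.Point, p • P = 0 → P = 0))
    {y : K} (hy : ‖y‖ ≤ 1) :
    ∃ P ∈ (((integralModelInt W).map (Int.castRingHom ℤ_[p])).map (coeffHom p K)).nonsingularReductionSubgroup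
        (Valuation.integer.integers (NormedField.valuation (K := K))),
      padicLogPointFiniteExt (NormedField.valuation (K := K))
        (curveK p K ((integralModelInt W).map (Int.castRingHom ℤ_[p]))) p P = y := by
  haveI := isElliptic_map_integralModelInt_padic (p := p) W
  obtain ⟨hΔ, hc₄⟩ := norm_Δ_lt_one_of_addv (p := p) W hadd
  exact exists_mem_nonsingularReductionSubgroup_padicLogPointFiniteExt_eq (by omega) hK hΔ hc₄
    (fun _ hP hpP => noPTorsion_of_addv_of_katoClause W hp5 hadd hK hcl hP hpP) hy

/-- ★ **THE RECEPTACLE OF F″ AS A THEOREM ((S5b) trace form).** `W/ℚ` globally minimal, `Addv W p`, `5 ≤ p`, `K/ℚ_p`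
finite Galois UNRAMIFIED, F″'s clause `7 < p ∨ (gcd([K : ℚ_p], p − 1) = 1 ∧ ∀ P : (W ⊗ ℚ_p)(ℚ_p), p • P = 0 → P = 0)`:
if `‖Tr_{K/ℚ_p}(a · log_ω P)‖ ≤ 1` for every `P ∈ E(K)` of `W_ℤ ⊗ K`, then `‖Tr_{K/ℚ_p}(a · o)‖ ≤ 1` for every
`o ∈ 𝒪_K` — with (S5b) this is `exp*_ω(H¹(K_v, T_pE)) ⊆ 𝒪_v`, item 2 of F″'s derivation (Kim–Nakamura Cor. 2.4),
now a theorem for EVERY curve, prime and completion F″ quantifies over. [cite: KimNakamura2020, Cor. 2.4]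
[cite: KostersPannekoek2017, Thm. 1 and Cor. 2] [cite: Kato2004Asterisque, (8.1.3) and Thm. 9.7 (the consumer)] -/
theorem norm_trace_mul_le_one_of_forall_point_of_addv_of_katoClause (hp5 : 5 ≤ p)
    (hadd : Rank1Residual.Addv W p) (hK : ∀ z : K, ‖z‖ < 1 → ‖z‖ ≤ ‖(p : K)‖)
    (hcl : 7 < p ∨ (Nat.Coprime (Module.finrank ℚ_[p] K) (p - 1) ∧
      ∀ P : (W.baseChange ℚ_[p]).toAffine.Point, p • P = 0 → P = 0))
    {a : K}
    (ha : ∀ P : (curveK p K ((integralModelInt W).map (Int.castRingHom ℤ_[p]))).toAffine.Point,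
      ‖Algebra.trace ℚ_[p] K (a * padicLogPointFiniteExt (NormedField.valuation (K := K))
        (curveK p K ((integralModelInt W).map (Int.castRingHom ℤ_[p]))) p P)‖ ≤ 1)
    {o : K} (ho : ‖o‖ ≤ 1) : ‖Algebra.trace ℚ_[p] K (a * o)‖ ≤ 1 := by
  haveI := isElliptic_map_integralModelInt_padic (p := p) W
  obtain ⟨hΔ, hc₄⟩ := norm_Δ_lt_one_of_addv (p := p) W hadd
  exact norm_trace_mul_le_one_of_forall_point (by omega) hK hΔ hc₄
    (fun _ hP hpP => noPTorsion_of_addv_of_katoClause W hp5 hadd hK hcl hP hpP) ha ho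

end Rat

end Summit.BirchSwinnertonDyer.BirchSwinnertonDyer.Theorems.ReceptacleTorsion

end
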